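import Summits.BirchSwinnertonDyer.BirchSwinnertonDyer.Theorems.ThetaPartnerAtTwoSignedKatoUpToAtTwoMultiplierAvoidance
import Literature.NumberTheory.EllipticCurves.PAdicLFunctionMinus
import Literature.NumberTheory.EllipticCurves.RohrlichNonvanishingProofs
import Literature.NumberTheory.EllipticCurves.IwasawaAlgebra
import Mathlib.FieldTheory.IsAlgClosed.AlgebraicClosure
import Mathlib.RingTheory.RootsOfUnity.AlgebraicallyClosed
import Mathlib.Analysis.Complex.Polynomial.Basic
import HarnessLib

/-!
# Route `ThetaPartnerAtTwo` (TP2), crux K3 `SignedKatoDivisibilityUpToAtTwo` (item stmt-BirchSwinnertonDyer-20308) /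
# K3P′ (stmt-BirchSwinnertonDyer-25631), line `colemanrat` v12 — brick MULT-AVOID, §3–§4: KATO'S FOUR-CUSP MULTIPLIER AT
# `p = 2` WITH `2`-POWER AUXILIARY CUSPS AVOIDS ANY GIVEN PRIME `𝔭 ∌ 2` OF `Λ = ℤ₂⟦T⟧`

Width seat `bsd-wall-tp2-p2x-w5` g0 (cell `bsd-wall`). HONEST FRAMING: theorems only (no definition, no named fact, no instance,
no `sorry`); closes no item; K3 / K3P′ are NOT settled and BSD is NOT proved by any of this.

## What is here

The `∀ 𝔭 ∃ μ ∉ 𝔭` clause of the published-input stub (CORE_pair / CORE_χ) for Kato's `(c, d, a(A))`-elements, i.e. Kato's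
per-prime CHOICE OF AUXILIARY DATA (§13.9–13.14), in the kernel, for the auxiliary modulus `A = 2^{k+3}` (a power of `p = 2`:
NO tame Euler factors in the multiplier; Kato's guards `(c, 6pA) = (d, 6pN) = 1` allow it; `A ≥ 8` avoids the vanishing
`[a/A]⁻ = 0` for `A ∣ 2`, `EulerSystemValues` (P4)):

* §3 `exists_forall_ratMinusTwistedSymbolSum_ne_zero` — from the TREE theorems Rohrlich at `2`
  (`Rohrlich1984_nonvanishing_twists.primePow_of_isNewformOf`, `2 ∤ N`) and Birch for odd characters
  (`ratMinusTwistedSymbolSum_mul_minusPeriod_mul_I`): there is `k₀` such that EVERY odd primitive `χ` mod `2^{k+3}`, `k ≥ k₀`,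
  has `Σ_a χ(a)[a/2^{k+3}]⁻_f ≠ 0` (`= τ(χ)L(f, χ̄, 1)/(Ω⁻ i)`, and `χ̄` is not one of Rohrlich's finitely many exceptions).
* §4 `exists_fourTerm_not_mem` — **THE AVOIDANCE THEOREM**: for the newform `f` of `W/ℚ` with `2 ∤ N` there is `k` such that
  for EVERY prime `𝔭` of `Λ = IwasawaAlgebra 2` with `2 ∉ 𝔭`, all integers `c ≡ d ≡ 5 (mod 2^{k+3})`, `d d′ ≡ 1`, every
  integral normalisation `n(a) = D·[a/2^{k+3}]⁻_f` (`D ∈ ℚˣ`) and ALL `X, Y ∈ Λ`, some cusp `a` has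
  `c²d²·n(a) − cd²·n(ac)·X − c²d·n(ad′)·Y + cd·n(acd′)·X·Y ∉ 𝔭` — the four-cusp multiplier of Kato's value law
  (`EulerSystemValues.cuspFactor f true χ̄ c d a A d′ = c²d²[a/A]⁻ − cd²χ̄(c)[ac/A]⁻ − c²dχ̄(d)[ad′/A]⁻ + cdχ̄(cd)[acd′/A]⁻`,
  `Kato2004.katoMultiplier … E = ∅`) with `χ̄(c), χ̄(d)` replaced by ARBITRARY `X, Y` (in the assembly: the images
  `Ψ(σ_c), Ψ(σ_d) ∈ Λˣ`, `IwasawaCharacter.Psi`; nothing about them is needed). Proof: §1–§2 of `…MultiplierAvoidance` in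
  `L = ` an algebraic closure of `Frac(Λ/𝔭)` (characteristic `0` because `2 ∉ 𝔭` and odd integers are units of `ℤ₂`), with the
  three odd primitive characters built over `ℚ̄` and read in `ℂ` (§3) and in `L`.

What the K3 assembly does with it (not here): take Kato's class for `(c, d, a, A) = (5, d, a, 2^{k+3})`, `d ≡ 5 (2^{k+3})`,
`(d, 6N) = 1`; its (C5)-values at the even characters `χ` of the layer are `κ·L(f,χ̄,1)/Ω⁺·cuspFactor`, and
`cuspFactor = μ_a(χ)` for the `Λ`-element `μ_a` above with `X = Ψ_c`, `Y = Ψ_d`; this file supplies `μ_a ∉ 𝔭`.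

References: [Kato2004Asterisque] Thm. 6.6 (1) (p. 163), §13.9 (p. 229), Lemma 13.10–13.11 (pp. 230–231), §13.13–13.14
(pp. 232–234), Ex. 13.3 (p. 225); [RohrlichInventiones1984] Theorem (p. 409); [MazurTateTeitelbaum1986Invent] §I.8 (8.6).
-/

set_option autoImplicit false
-- the Theorems namespace of this sub repeats the summit name by design (D-0017 nested layout)
set_option linter.dupNamespace false

noncomputable section

open scoped Classical

open Finset Literature.NumberTheory.EllipticCurves Literature.NumberTheory.EllipticCurves.ModularForms

namespace Summit.BirchSwinnertonDyer.BirchSwinnertonDyer.Theorems.SignedKatoOffTwo.MultAvoid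

/-! ## §3 Non-vanishing of the minus twisted symbol sums at odd primitive characters of large `2`-power conductor -/

section Complex

/-- The minus twisted symbol sum is compatible with ring homomorphisms of the coefficient field (the `[a/m]⁻` are rational).
[folklore] -/
theorem ratMinusTwistedSymbolSum_ringHomComp {K K' : Type*} [Field K] [Field K'] (g : K →+* K') {N : ℕ}
    (f : CuspForm (CongruenceSubgroup.Gamma0 N) 2) {m : ℕ} [NeZero m] (χ : DirichletCharacter K m) :
    ratMinusTwistedSymbolSum f (χ.ringHomComp g) = g (ratMinusTwistedSymbolSum f χ) := by
  simp only [ratMinusTwistedSymbolSum, map_sum, map_mul, map_ratCast, MulChar.ringHomComp_apply]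

variable {N : ℕ} [NeZero N] {W : WeierstrassCurve ℚ} [W.IsElliptic] {f : CuspForm (CongruenceSubgroup.Gamma0 N) 2}

/-- **Odd twists of large `2`-power conductor see the minus symbols.** For the newform `f` of an elliptic curve `W/ℚ` with
`2 ∤ N` there is `k₀` such that for every `k ≥ k₀` and every ODD PRIMITIVE Dirichlet character `χ` mod `2^{k+3}`,
`Σ_{a mod 2^{k+3}} χ(a)[a/2^{k+3}]⁻_f ≠ 0`: by Birch's formula (tree theorem `ratMinusTwistedSymbolSum_mul_minusPeriod_mul_I`)
the sum is `τ(χ)L(f, χ̄, 1)/(Ω⁻_f i)` with `τ(χ) ≠ 0` (`gaussSum_stdAddChar_ne_zero`), and by Rohrlich's theorem at `2`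
(tree theorem `Rohrlich1984_nonvanishing_twists.primePow_of_isNewformOf`) only finitely many primitive `χ̄` of `2`-power
conductor have `L(f, χ̄, 1) = 0` — none of conductor `2^{k+3}` once `2^{k+3}` exceeds their levels.
[cite: RohrlichInventiones1984, Theorem (p. 409)] [cite: MazurTateTeitelbaum1986Invent, §I.8 (8.6)] -/
theorem exists_forall_ratMinusTwistedSymbolSum_ne_zero (hfW : IsNewformOf W f) (h2N : ¬ 2 ∣ N) :
    ∃ k₀ : ℕ, ∀ k : ℕ, k₀ ≤ k → ∀ χ : DirichletCharacter ℂ (2 ^ (k + 3)), χ.IsPrimitive → χ.Odd →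
      ratMinusTwistedSymbolSum f χ ≠ 0 := by
  have hfin := Rohrlich1984_nonvanishing_twists.primePow_of_isNewformOf hfW (p := 2) h2N
  obtain ⟨B, hB⟩ := (hfin.image Sigma.fst).bddAbove
  refine ⟨B, fun k hk χ hχ hχo h0 ↦ ?_⟩
  haveI : NeZero (2 ^ (k + 3)) := ⟨pow_ne_zero _ two_ne_zero⟩
  obtain ⟨L, hL, hL'⟩ := exists_differentiable_eq_twistedLSeries_holds f (m := 2 ^ (k + 3)) χ⁻¹
  have hBirch := ratMinusTwistedSymbolSum_mul_minusPeriod_mul_I f hfW.1 hfW.coeffField_eq_bot hχ hχo hL hL'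
  rw [h0, zero_mul, zero_mul] at hBirch
  have hL1 : L 1 = 0 := (mul_eq_zero.mp hBirch.symm).resolve_left (gaussSum_stdAddChar_ne_zero hχ)
  have hχ' : χ⁻¹.IsPrimitive := by
    rw [DirichletCharacter.isPrimitive_def, DirichletCharacter.conductor_inv]; exact hχ
  have hmem : (⟨2 ^ (k + 3), χ⁻¹⟩ : Σ m : ℕ, DirichletCharacter ℂ m) ∈
      {χ : Σ m : ℕ, DirichletCharacter ℂ m |
        χ.1 ≠ 0 ∧ χ.1.primeFactors ⊆ {2} ∧ χ.2.IsPrimitive ∧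
          ∃ L : ℂ → ℂ, Differentiable ℂ L ∧ (∀ s : ℂ, 2 < s.re → L s = twistedLSeries f χ.2 s) ∧ L 1 = 0} := by
    refine ⟨pow_ne_zero _ two_ne_zero, ?_, hχ', L, hL, hL', hL1⟩
    rw [Nat.primeFactors_prime_pow (by omega) Nat.prime_two]
  have hle : 2 ^ (k + 3) ≤ B := hB (Set.mem_image_of_mem Sigma.fst hmem)
  have hlt : k + 3 < 2 ^ (k + 3) := Nat.lt_two_pow_self
  omega

end Complex

/-! ## §4 The avoidance theorem in `Λ = ℤ₂⟦T⟧` -/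

section Iwasawa

/-- In `Λ = ℤ₂⟦T⟧`, a prime ideal not containing `2` contains no non-zero constant: `x = u·2^v` with `u ∈ ℤ₂ˣ`.
[cite: Washington1997, §13.2] -/
theorem C_not_mem_of_ne_zero {𝔭 : Ideal (IwasawaAlgebra 2)} [𝔭.IsPrime]
    (h2 : PowerSeries.C (2 : ℤ_[2]) ∉ 𝔭) {x : ℤ_[2]} (hx : x ≠ 0) : PowerSeries.C x ∉ 𝔭 := by
  haveI : Fact (Nat.Prime 2) := ⟨Nat.prime_two⟩
  intro hmem
  rw [PadicInt.unitCoeff_spec hx, map_mul, map_pow, map_natCast] at hmem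
  rcases Ideal.IsPrime.mem_or_mem ‹𝔭.IsPrime› hmem with hu | hp
  · exact Ideal.IsPrime.ne_top ‹𝔭.IsPrime›
      (Ideal.eq_top_of_isUnit_mem _ hu ((Units.isUnit _).map PowerSeries.C))
  · have h2' : ((2 : ℕ) : IwasawaAlgebra 2) = PowerSeries.C (2 : ℤ_[2]) := by
      rw [map_ofNat]; rfl
    rw [h2'] at hp
    exact h2 (Ideal.IsPrime.mem_of_pow_mem ‹𝔭.IsPrime› _ hp)

variable {N : ℕ} [NeZero N] {W : WeierstrassCurve ℚ} [W.IsElliptic] {f : CuspForm (CongruenceSubgroup.Gamma0 N) 2}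

/-- **The avoidance theorem, field form.** For the newform `f` of `W/ℚ` with `2 ∤ N` there is `k` such that in EVERY algebraically
closed field `L` of characteristic `0`, for all integers `c ≡ d ≡ 5 (mod 2^{k+3})`, `d d′ ≡ 1 (mod 2^{k+3})`, every integral
normalisation `n(a) = D·[a/2^{k+3}]⁻_f` (`D ∈ ℚˣ`) and ALL `x, y ∈ L`, some cusp `a ∈ ℤ/2^{k+3}` has
`c²d²·n(a) − cd²·n(ac)·x − c²d·n(ad′)·y + cd·n(acd′)·x·y ≠ 0` in `L`: the three odd primitive characters of
`exists_three_odd_primitive` over `ℚ̄` are read in `ℂ` (non-vanishing, §3) and in `L` (`exists_fourTerm_ne_zero`).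
[cite: Kato2004Asterisque, Lemma 13.11 (pp. 230–231), §13.13–13.14 (pp. 232–234)] [cite: RohrlichInventiones1984, Theorem (p. 409)] -/
theorem exists_forall_fourTerm_ne_zero (hfW : IsNewformOf W f) (h2N : ¬ 2 ∣ N) :
    ∃ k : ℕ, ∀ (L : Type) [Field L] [CharZero L] [IsAlgClosed L],
      ∀ (c d d' : ℤ), (c : ZMod (2 ^ (k + 3))) = 5 → (d : ZMod (2 ^ (k + 3))) = 5 →
        (d : ZMod (2 ^ (k + 3))) * (d' : ZMod (2 ^ (k + 3))) = 1 →
      ∀ (D : ℚ), D ≠ 0 → ∀ (n : ZMod (2 ^ (k + 3)) → ℤ),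
        (∀ a : ZMod (2 ^ (k + 3)), (n a : ℚ) = D * ratMinusSymbol f ((a.val : ℚ) / ((2 ^ (k + 3) : ℕ) : ℚ))) →
      ∀ (x y : L), ∃ a : ZMod (2 ^ (k + 3)),
        (c : L) ^ 2 * (d : L) ^ 2 * (n a : L) - (c : L) * (d : L) ^ 2 * (n (a * c) : L) * x -
            (c : L) ^ 2 * (d : L) * (n (a * d') : L) * y + (c : L) * (d : L) * (n (a * c * d') : L) * x * y ≠ 0 := by
  haveI : Fact (Nat.Prime 2) := ⟨Nat.prime_two⟩
  obtain ⟨k₀, hk₀⟩ := exists_forall_ratMinusTwistedSymbolSum_ne_zero hfW h2N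
  refine ⟨max k₀ 2, ?_⟩
  have hk2 : 2 ≤ max k₀ 2 := le_max_right _ _
  have hkk₀ : k₀ ≤ max k₀ 2 := le_max_left _ _
  generalize max k₀ 2 = k at hk2 hkk₀ ⊢
  intro L _ _ _ c d d' hc hd hdd' D hD n hn x y
  haveI : NeZero (2 ^ (k + 3)) := ⟨pow_ne_zero _ two_ne_zero⟩
  -- the three characters over `ℚ̄`, read in `ℂ` and in `L`
  haveI : NeZero (Nat.totient (2 ^ (k + 3))) := ⟨(Nat.totient_pos.mpr (NeZero.pos _)).ne'⟩
  haveI : Algebra.IsAlgebraic ℚ (AlgebraicClosure ℚ) := AlgebraicClosure.isAlgebraic ℚ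
  obtain ⟨Ψ, hΨ, hΨinj⟩ := exists_three_odd_primitive (K := AlgebraicClosure ℚ) k hk2 two_ne_zero
  let σ : AlgebraicClosure ℚ →+* ℂ := (IsAlgClosed.lift : AlgebraicClosure ℚ →ₐ[ℚ] ℂ).toRingHom
  let τ : AlgebraicClosure ℚ →+* L := (IsAlgClosed.lift : AlgebraicClosure ℚ →ₐ[ℚ] L).toRingHom
  -- non-vanishing of the minus sums of `(Ψ i)⁻¹`
  have hne : ∀ i : Fin 3, ratMinusTwistedSymbolSum f (Ψ i)⁻¹ ≠ 0 := by
    intro i h0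
    have hprim : DirichletCharacter.IsPrimitive (((Ψ i)⁻¹).ringHomComp σ) := by
      rw [isPrimitive_ringHomComp_iff, DirichletCharacter.isPrimitive_def, DirichletCharacter.conductor_inv]
      exact (hΨ i).2
    have hodd : DirichletCharacter.Odd (((Ψ i)⁻¹).ringHomComp σ) := by
      show (((Ψ i)⁻¹).ringHomComp σ) (-1) = -1
      rw [MulChar.ringHomComp_apply, MulChar.inv_apply_eq_inv']
      have h1 : (Ψ i) (-1) = -1 := (hΨ i).1
      rw [h1, inv_neg_one, map_neg, map_one]
    have h := hk₀ k hkk₀ _ hprim hodd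
    rw [ratMinusTwistedSymbolSum_ringHomComp, h0, map_zero] at h
    exact h rfl
  -- the set `S` of the three characters read in `L`
  set S : Finset (DirichletCharacter L (2 ^ (k + 3))) := Finset.univ.image fun i ↦ (Ψ i).ringHomComp τ with hSdef
  have hΨτinj : Function.Injective fun i : Fin 3 ↦ (Ψ i).ringHomComp τ := by
    intro i j hij
    apply hΨinj
    have h := congrArg (fun χ : DirichletCharacter L (2 ^ (k + 3)) ↦ χ (5 : ZMod (2 ^ (k + 3)))) hij
    simp only [MulChar.ringHomComp_apply] at h
    exact τ.injective h
  have hScard : 2 < S.card := by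
    rw [hSdef, Finset.card_image_of_injective _ hΨτinj, Finset.card_univ, Fintype.card_fin]; norm_num
  -- `5` as a unit of `ℤ/2^{k+3}` and the substitutions `c ↦ 5`, `d' ↦ 5⁻¹`
  have h5 : IsUnit (5 : ZMod (2 ^ (k + 3))) := by
    have h := (ZMod.isUnit_iff_coprime 5 (2 ^ (k + 3))).mpr (Nat.Coprime.pow_right (k + 3) (by norm_num))
    exact_mod_cast h
  obtain ⟨u, hu⟩ := h5
  have hc' : (c : ZMod (2 ^ (k + 3))) = u := by rw [hc, hu]
  have hd'' : (d' : ZMod (2 ^ (k + 3))) = ((u⁻¹ : (ZMod (2 ^ (k + 3)))ˣ) : ZMod (2 ^ (k + 3))) := by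
    rw [hd, ← hu] at hdd'
    calc (d' : ZMod (2 ^ (k + 3))) = ((u⁻¹ : (ZMod (2 ^ (k + 3)))ˣ) : ZMod (2 ^ (k + 3))) * (u * d') := by
          rw [← mul_assoc, Units.inv_mul, one_mul]
      _ = ((u⁻¹ : (ZMod (2 ^ (k + 3)))ˣ) : ZMod (2 ^ (k + 3))) := by rw [hdd', mul_one]
  have hinjS : Set.InjOn (fun ψ : DirichletCharacter L (2 ^ (k + 3)) ↦ ψ u) S := by
    intro ψ hψ ψ' hψ' h
    rw [hSdef, Finset.coe_image, Finset.coe_univ, Set.image_univ, Set.mem_range] at hψ hψ'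
    obtain ⟨i, rfl⟩ := hψ
    obtain ⟨j, rfl⟩ := hψ'
    simp only [hu, MulChar.ringHomComp_apply] at h
    rw [hΨinj (τ.injective h)]
  -- `c, d ≠ 0`
  have hfive : (5 : ZMod (2 ^ (k + 3))) ≠ 0 := by
    intro h
    have h' := congrArg ZMod.val h
    rw [ZMod.val_zero, ZMod.val_ofNat, Nat.mod_eq_of_lt (by
      calc 5 < 2 ^ 3 := by norm_num
        _ ≤ 2 ^ (k + 3) := Nat.pow_le_pow_right (by norm_num) (by omega))] at h'
    omega
  have hc0 : (c : L) ≠ 0 := by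
    have : c ≠ 0 := by rintro rfl; rw [Int.cast_zero] at hc; exact hfive hc.symm
    exact_mod_cast this
  have hd0 : (d : L) ≠ 0 := by
    have : d ≠ 0 := by rintro rfl; rw [Int.cast_zero] at hd; exact hfive hd.symm
    exact_mod_cast this
  have hF : ∀ ψ ∈ S, ∑ a : ZMod (2 ^ (k + 3)), ψ⁻¹ a * ((n a : ℤ) : L) ≠ 0 := by
    intro ψ hψ
    rw [hSdef, Finset.mem_image] at hψ
    obtain ⟨i, -, rfl⟩ := hψ
    have hsum : ∑ a : ZMod (2 ^ (k + 3)), ((Ψ i).ringHomComp τ)⁻¹ a * ((n a : ℤ) : L) =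
        (D : L) * τ (ratMinusTwistedSymbolSum f (Ψ i)⁻¹) := by
      rw [← ratMinusTwistedSymbolSum_ringHomComp, ← MulChar.ringHomComp_inv, ratMinusTwistedSymbolSum,
        Finset.mul_sum]
      refine Finset.sum_congr rfl fun a _ ↦ ?_
      have hna : ((n a : ℤ) : L) = ((D * ratMinusSymbol f ((a.val : ℚ) / ((2 ^ (k + 3) : ℕ) : ℚ)) : ℚ) : L) := by
        rw [← hn a, Rat.cast_intCast]
      rw [hna, Rat.cast_mul]
      ring
    rw [hsum]
    exact mul_ne_zero (Rat.cast_ne_zero.mpr hD) ((map_ne_zero τ).mpr (hne i))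
  obtain ⟨a, ha⟩ := exists_fourTerm_ne_zero (fun a : ZMod (2 ^ (k + 3)) ↦ ((n a : ℤ) : L)) hc0 hd0 x y
    u u S hScard hinjS hinjS hF
  refine ⟨a, ?_⟩
  rw [hc', hd'']
  exact ha

/-- **KATO'S FOUR-CUSP MULTIPLIER AT `p = 2` AVOIDS ANY GIVEN PRIME `𝔭 ∌ 2` OF `Λ` (auxiliary modulus `A = 2^{k+3}`).**
Let `f` be the newform of an elliptic curve `W/ℚ` of level `N` with `2 ∤ N`. There is `k : ℕ` such that: for every prime
`𝔭` of `Λ = ℤ₂⟦T⟧` with `2 ∉ 𝔭`, all integers `c, d, d′` with `c ≡ d ≡ 5 (mod 2^{k+3})`, `d d′ ≡ 1 (mod 2^{k+3})`, every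
non-zero `D ∈ ℚ` and integers `n(a)` with `n(a) = D·[a/2^{k+3}]⁻_f` (a common denominator cleared), and ALL `X, Y ∈ Λ`,
some `a ∈ ℤ/2^{k+3}` has
`c²d²·n(a) − cd²·n(ac)·X − c²d·n(ad′)·Y + cd·n(acd′)·X·Y ∉ 𝔭`.
This is the multiplier of Kato's value law for the `(c, d, a(2^{k+3}))`-element (Thm. 6.6 (1) / Lemma 13.10 (1): four-cusp
factor `c²d²[a/A]⁻ − cd²χ̄(c)[ac/A]⁻ − c²dχ̄(d)[ad′/A]⁻ + cdχ̄(cd)[acd′/A]⁻`, no tame Euler factors since `prime(A) = {p}`)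
with the group elements `σ_c, σ_d` replaced by arbitrary `X, Y`; Kato's per-prime choice of auxiliary data (§13.13–13.14)
thus holds in the kernel at `p = 2`. Proof: `exists_forall_fourTerm_ne_zero` in an algebraic closure `L` of `Frac(Λ/𝔭)`
(characteristic `0`: `C_not_mem_of_ne_zero`).
[cite: Kato2004Asterisque, Thm. 6.6 (1) (p. 163), Lemma 13.10–13.11 (pp. 230–231), §13.13–13.14 (pp. 232–234)]
[cite: RohrlichInventiones1984, Theorem (p. 409)] -/
theorem exists_fourTerm_not_mem (hfW : IsNewformOf W f) (h2N : ¬ 2 ∣ N) :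
    ∃ k : ℕ, ∀ (𝔭 : PrimeSpectrum (IwasawaAlgebra 2)), PowerSeries.C (2 : ℤ_[2]) ∉ 𝔭.asIdeal →
      ∀ (c d d' : ℤ), (c : ZMod (2 ^ (k + 3))) = 5 → (d : ZMod (2 ^ (k + 3))) = 5 →
        (d : ZMod (2 ^ (k + 3))) * (d' : ZMod (2 ^ (k + 3))) = 1 →
      ∀ (D : ℚ), D ≠ 0 → ∀ (n : ZMod (2 ^ (k + 3)) → ℤ),
        (∀ a : ZMod (2 ^ (k + 3)), (n a : ℚ) = D * ratMinusSymbol f ((a.val : ℚ) / ((2 ^ (k + 3) : ℕ) : ℚ))) →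
      ∀ (X Y : IwasawaAlgebra 2), ∃ a : ZMod (2 ^ (k + 3)),
        ((c ^ 2 * d ^ 2 * n a : ℤ) : IwasawaAlgebra 2) - ((c * d ^ 2 * n (a * c) : ℤ) : IwasawaAlgebra 2) * X -
            ((c ^ 2 * d * n (a * d') : ℤ) : IwasawaAlgebra 2) * Y +
            ((c * d * n (a * c * d') : ℤ) : IwasawaAlgebra 2) * X * Y ∉ 𝔭.asIdeal := by
  haveI : Fact (Nat.Prime 2) := ⟨Nat.prime_two⟩
  obtain ⟨k, hk⟩ := exists_forall_fourTerm_ne_zero hfW h2N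
  refine ⟨k, fun 𝔭 h2 c d d' hc hd hdd' D hD n hn X Y ↦ ?_⟩
  haveI hIp : 𝔭.asIdeal.IsPrime := 𝔭.isPrime
  let φ : IwasawaAlgebra 2 →+* AlgebraicClosure (FractionRing (IwasawaAlgebra 2 ⧸ 𝔭.asIdeal)) :=
    ((algebraMap (FractionRing (IwasawaAlgebra 2 ⧸ 𝔭.asIdeal))
        (AlgebraicClosure (FractionRing (IwasawaAlgebra 2 ⧸ 𝔭.asIdeal)))).comp
      (algebraMap (IwasawaAlgebra 2 ⧸ 𝔭.asIdeal) (FractionRing (IwasawaAlgebra 2 ⧸ 𝔭.asIdeal)))).comp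
      (Ideal.Quotient.mk 𝔭.asIdeal)
  have hφ0 : ∀ x : IwasawaAlgebra 2, φ x = 0 ↔ x ∈ 𝔭.asIdeal := by
    intro x
    simp only [φ, RingHom.coe_comp, Function.comp_apply,
      map_eq_zero_iff _ (algebraMap (FractionRing (IwasawaAlgebra 2 ⧸ 𝔭.asIdeal))
        (AlgebraicClosure (FractionRing (IwasawaAlgebra 2 ⧸ 𝔭.asIdeal)))).injective,
      map_eq_zero_iff _ (IsFractionRing.injective (IwasawaAlgebra 2 ⧸ 𝔭.asIdeal)
        (FractionRing (IwasawaAlgebra 2 ⧸ 𝔭.asIdeal))), Ideal.Quotient.eq_zero_iff_mem]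
  haveI hL0 : CharZero (AlgebraicClosure (FractionRing (IwasawaAlgebra 2 ⧸ 𝔭.asIdeal))) := by
    refine (CharZero.charZero_iff_forall_prime_ne_zero _).mpr fun q hq ↦ ?_
    have hq0 : (q : ℤ_[2]) ≠ 0 := Nat.cast_ne_zero.mpr hq.ne_zero
    have h := C_not_mem_of_ne_zero (𝔭 := 𝔭.asIdeal) h2 hq0
    rw [map_natCast (PowerSeries.C : ℤ_[2] →+* IwasawaAlgebra 2)] at h
    rw [← map_natCast φ, Ne, hφ0]
    exact h
  obtain ⟨a, ha⟩ := hk (AlgebraicClosure (FractionRing (IwasawaAlgebra 2 ⧸ 𝔭.asIdeal))) c d d' hc hd hdd' D hD n hn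
    (φ X) (φ Y)
  refine ⟨a, fun hmem ↦ ha ?_⟩
  have himg := (hφ0 _).mpr hmem
  simpa only [map_add, map_sub, map_mul, map_intCast, map_pow, Int.cast_mul, Int.cast_pow] using himg

end Iwasawa

end Summit.BirchSwinnertonDyer.BirchSwinnertonDyer.Theorems.SignedKatoOffTwo.MultAvoid

end
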